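import Summits.PneNP.PneNP.Theorems.ClusUniversalCertificateCoordColumns

/-!
# Route ClusUniversalCertificate, crux `UniversalCertAll` (stmt-PneNP-19683) — the HYPERPLANE MASS BOUND

Support theorem (closes nothing) for the OPEN crux `Summit.PneNP.PneNP.Theses.ClusUniversalCertificate.UniversalCertAll`
(route-PneNP-ClusUniversalCertificate, FRONTIER rung F-N1), in the vocabulary of record `ClusCoord.acodim` (the certificate codimension
`codim_Y(y)` of a point of `Y ⊆ 𝔽₂^M`, file `ClusUniversalCertificateCoordDefs`).

**Theorem (`hyperplane_mass_bound`).**  For every `Y ⊆ 𝔽₂^M` and every affine hyperplane `A = {ψ = c}` (`ψ ≠ 0`) NOT contained in `Y`,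
`2·|Y ∩ A| ≤ Σ_{y ∈ Y} codim_Y(y)`.  Tight on punctured hyperplanes.

WHY IT IS HERE.  The crux is the case `Φ = ⊔_j (Λ_j ∖ 0)` (block functionals) of the family of inequalities
`Σ_{y∈Y} codim_Y(y) ≥ −Σ_{φ ∈ Φ} 1̂_Y(φ)` for sets `Φ` of nonzero linear functionals (per block, `−Σ_{φ∈Λ_j∖0} 1̂_Y(φ) = |Y| − 2^{b_j} Z_j`);
the PROVED hypercube case (`ClusCube.l1Cert_holds`) is `Φ` = a basis.  This file proves the member `Φ = (𝔽₂^M)^* ∖ {0, ψ}` («all functionals but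
one»), whose demand at the translate `t ∉ Y`, `t ∈ A` is exactly `2|Y ∩ A|` — by exhaustive search (this seat's lab notes, M ≤ 4) the valid `Φ` are
NOT only block structures, and validity is conjecturally closed under direct sums (which would give the crux from one-block atoms).
PROOF.  Every point of `Y` has codimension `≥ 1` (`Y ≠ univ`), and codimension `1` exactly when it lies on an affine hyperplane inside `Y`
(`ClusCoordTwoBlocks.exists_functional_of_acodim_eq_one`).  Let `U` be the union of the affine hyperplanes contained in `Y`.  Its complement `K`
is closed under three-term sums (an intersection of affine hyperplanes), contains a point `p ∈ A ∖ Y`, and so `x ↦ x + q + p` injects `K ∖ A` into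
`K ∩ A`; since `|A| = |𝔽₂^M ∖ A|` this gives `|U ∩ A| ≤ |U ∖ A|`.  Hence `Σ_Y codim ≥ (2|Y∩A| − |U∩A|) + |U ∖ A| ≥ 2|Y ∩ A|`.
FRONTIER rung F-N1; elementary finite geometry over `𝔽₂`; nothing here bears on `P` versus `NP`.
-/

set_option linter.dupNamespace false -- `Summit.PneNP.PneNP.…`: summit = sub-problem name (D-0017 single-conjunct layout)

namespace Summit.PneNP.PneNP.Theorems.ClusHyperplaneMass

open Finset
open Summit.PneNP.PneNP.Theorems.ClusCoord (acodim)
open Summit.PneNP.PneNP.Theorems.ClusCoordTwoBlocks (one_le_acodim exists_functional_of_acodim_eq_one)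

variable {M : ℕ}

/-- Three-term sums preserve «lies on no affine hyperplane inside `Y`»: the complement of the union of the hyperplanes contained in `Y`
is closed under `x + y + z` (it is an intersection of affine hyperplanes). -/
theorem not_onHyperplane_add_add {Y : Finset (Fin M → ZMod 2)} {x y z : Fin M → ZMod 2}
    (hx : ¬ ∃ f : (Fin M → ZMod 2) →ₗ[ZMod 2] ZMod 2, ∀ w, f w = f x → w ∈ Y)
    (hy : ¬ ∃ f : (Fin M → ZMod 2) →ₗ[ZMod 2] ZMod 2, ∀ w, f w = f y → w ∈ Y)
    (hz : ¬ ∃ f : (Fin M → ZMod 2) →ₗ[ZMod 2] ZMod 2, ∀ w, f w = f z → w ∈ Y) :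
    ¬ ∃ f : (Fin M → ZMod 2) →ₗ[ZMod 2] ZMod 2, ∀ w, f w = f (x + y + z) → w ∈ Y := by
  rintro ⟨f, hf⟩
  have key : ∀ a b : ZMod 2, b ≠ a → b = a + 1 := by decide
  have hxa : f x ≠ f (x + y + z) := fun h => hx ⟨f, fun w hw => hf w (hw.trans h)⟩
  have hya : f y ≠ f (x + y + z) := fun h => hy ⟨f, fun w hw => hf w (hw.trans h)⟩
  have hza : f z ≠ f (x + y + z) := fun h => hz ⟨f, fun w hw => hf w (hw.trans h)⟩
  have hsum : f (x + y + z) = f x + f y + f z := by rw [map_add, map_add]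
  have hne : ∀ a : ZMod 2, a ≠ (a + 1) + (a + 1) + (a + 1) := by decide
  have ex : f x = f (x + y + z) + 1 := key _ _ hxa
  have ey : f y = f (x + y + z) + 1 := key _ _ hya
  have ez : f z = f (x + y + z) + 1 := key _ _ hza
  apply hne (f (x + y + z))
  calc f (x + y + z) = f x + f y + f z := hsum
    _ = (f (x + y + z) + 1) + (f (x + y + z) + 1) + (f (x + y + z) + 1) := by rw [ex, ey, ez]

/-- **Hyperplane mass bound.**  If the affine hyperplane `{x : ψ x = c}` (`ψ ≠ 0`) is not contained in `Y ⊆ 𝔽₂^M`, then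
`2·#{y ∈ Y : ψ y = c} ≤ Σ_{y∈Y} codim_Y(y)`. -/
theorem hyperplane_mass_bound (Y : Finset (Fin M → ZMod 2)) (ψ : (Fin M → ZMod 2) →ₗ[ZMod 2] ZMod 2) (hψ : ψ ≠ 0)
    (c : ZMod 2) (hA : ∃ p, ψ p = c ∧ p ∉ Y) :
    2 * ((Y.filter fun y => ψ y = c).card : ℤ) ≤ ∑ y ∈ Y, (acodim M Y y : ℤ) := by
  classical
  obtain ⟨p, hpc, hpY⟩ := hA
  have hY : Y ≠ univ := fun h => hpY (h ▸ mem_univ p)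
  -- `On x`: `x` lies on an affine hyperplane contained in `Y`
  set On : (Fin M → ZMod 2) → Prop :=
    fun x => ∃ f : (Fin M → ZMod 2) →ₗ[ZMod 2] ZMod 2, ∀ w, f w = f x → w ∈ Y with hOn
  have hOnY : ∀ x, On x → x ∈ Y := by
    rintro x ⟨f, hf⟩; exact hf x rfl
  have hpOn : ¬ On p := fun h => hpY (hOnY p h)
  -- the two parallel classes
  set A := (univ : Finset (Fin M → ZMod 2)).filter fun x => ψ x = c with hAdef
  set B := (univ : Finset (Fin M → ZMod 2)).filter fun x => ¬ ψ x = c with hBdef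
  have key : ∀ a b : ZMod 2, b ≠ a → b = a + 1 := by decide
  have h11 : ∀ a : ZMod 2, a + 1 ≠ a := by decide
  have h2c : ∀ a : ZMod 2, (a + 1) + (a + 1) + a = a := by decide
  -- a vector with `ψ v = 1`
  obtain ⟨v, hv⟩ : ∃ v, ψ v = 1 := by
    by_contra h
    have h' : ∀ v, ψ v ≠ 1 := fun v hv => h ⟨v, hv⟩
    have h01 : ∀ t : ZMod 2, t ≠ 1 → t = 0 := by decide
    exact hψ (LinearMap.ext fun x => by rw [LinearMap.zero_apply]; exact h01 _ (h' x))
  -- `|A| = |B|` via `x ↦ x + v`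
  have hAB : A.card = B.card := by
    apply le_antisymm
    · refine card_le_card_of_injOn (fun x => x + v) (fun x hx => ?_) (fun x _ y _ hxy => by simpa using hxy)
      have hx' : ψ x = c := (mem_filter.mp (mem_coe.mp hx)).2
      refine mem_coe.mpr (mem_filter.mpr ⟨mem_univ _, ?_⟩)
      rw [map_add, hx', hv]; exact h11 c
    · refine card_le_card_of_injOn (fun x => x + v) (fun x hx => ?_) (fun x _ y _ hxy => by simpa using hxy)
      have hx' : ¬ ψ x = c := (mem_filter.mp (mem_coe.mp hx)).2
      refine mem_coe.mpr (mem_filter.mpr ⟨mem_univ _, ?_⟩)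
      rw [map_add, key _ _ hx', hv, add_assoc, (by decide : (1 : ZMod 2) + 1 = 0), add_zero]
  -- the hyperplane-free parts `K ∩ A`, `K ∩ B` and the injection `x ↦ x + q + p : K ∩ B → K ∩ A`
  have hKBA : (B.filter fun x => ¬ On x).card ≤ (A.filter fun x => ¬ On x).card := by
    by_cases hq : ∃ q, q ∈ B.filter fun x => ¬ On x
    · obtain ⟨q, hq⟩ := hq
      have hqB : ¬ ψ q = c := (mem_filter.mp (mem_filter.mp hq).1).2
      have hqOn : ¬ On q := (mem_filter.mp hq).2
      refine card_le_card_of_injOn (fun x => x + q + p) (fun x hx => ?_) (fun x _ y _ hxy => by simpa using hxy)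
      have hx := mem_filter.mp (mem_coe.mp hx)
      have hxB : ¬ ψ x = c := (mem_filter.mp hx.1).2
      refine mem_coe.mpr (mem_filter.mpr ⟨mem_filter.mpr ⟨mem_univ _, ?_⟩, not_onHyperplane_add_add hx.2 hqOn hpOn⟩)
      rw [map_add, map_add, key _ _ hxB, key _ _ hqB, hpc]; exact h2c c
    · rw [Finset.eq_empty_iff_forall_notMem.mpr (fun q hq' => hq ⟨q, hq'⟩), card_empty]; exact Nat.zero_le _
  -- hence `|U ∩ A| ≤ |U ∩ B|`
  have hsplitA := Finset.card_filter_add_card_filter_not (s := A) (fun x => On x)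
  have hsplitB := Finset.card_filter_add_card_filter_not (s := B) (fun x => On x)
  have hUAB : (A.filter fun x => On x).card ≤ (B.filter fun x => On x).card := by omega
  -- the A-side of `Y`: codimension `≥ 2` off `U`, `≥ 1` on `U`
  have hYA : 2 * ((Y.filter fun y => ψ y = c).card : ℤ) - ((A.filter fun x => On x).card : ℤ) ≤
      ∑ y ∈ Y.filter (fun y => ψ y = c), (acodim M Y y : ℤ) := by
    have hpt : ∀ y ∈ Y.filter (fun y => ψ y = c), (if On y then (1 : ℤ) else 2) ≤ (acodim M Y y : ℤ) := by
      intro y hy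
      have hyY : y ∈ Y := (mem_filter.mp hy).1
      have h1 : 1 ≤ acodim M Y y := one_le_acodim hY hyY
      split_ifs with hon
      · exact_mod_cast h1
      · have h2 : acodim M Y y ≠ 1 := fun h => hon (exists_functional_of_acodim_eq_one hY hyY h)
        have : 2 ≤ acodim M Y y := by omega
        exact_mod_cast this
    have hsum := Finset.sum_le_sum hpt
    rw [Finset.sum_ite, sum_const, sum_const, nsmul_eq_mul, nsmul_eq_mul, mul_one] at hsum
    have hsplitY := Finset.card_filter_add_card_filter_not (s := Y.filter fun y => ψ y = c) (fun x => On x)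
    have hsub : ((Y.filter fun y => ψ y = c).filter fun x => On x).card ≤ (A.filter fun x => On x).card := by
      refine card_le_card fun y hy => ?_
      have hy' := mem_filter.mp hy
      exact mem_filter.mpr ⟨mem_filter.mpr ⟨mem_univ _, (mem_filter.mp hy'.1).2⟩, hy'.2⟩
    have e1 : (((Y.filter fun y => ψ y = c).filter fun x => On x).card : ℤ) +
        (((Y.filter fun y => ψ y = c).filter fun x => ¬ On x).card : ℤ) = ((Y.filter fun y => ψ y = c).card : ℤ) := by
      exact_mod_cast hsplitY
    have e2 : (((Y.filter fun y => ψ y = c).filter fun x => On x).card : ℤ) ≤ ((A.filter fun x => On x).card : ℤ) := by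
      exact_mod_cast hsub
    linarith
  -- the B-side of `Y`: every point has codimension `≥ 1`, and `U ∩ B ⊆ Y ∩ B`
  have hYB : ((B.filter fun x => On x).card : ℤ) ≤ ∑ y ∈ Y.filter (fun y => ¬ ψ y = c), (acodim M Y y : ℤ) := by
    have hpt : ∀ y ∈ Y.filter (fun y => ¬ ψ y = c), (1 : ℤ) ≤ (acodim M Y y : ℤ) := by
      intro y hy
      exact_mod_cast one_le_acodim hY (mem_filter.mp hy).1
    have hsum := Finset.sum_le_sum hpt
    rw [sum_const, nsmul_eq_mul, mul_one] at hsum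
    have hsub : (B.filter fun x => On x).card ≤ (Y.filter fun y => ¬ ψ y = c).card := by
      refine card_le_card fun y hy => ?_
      have hy' := mem_filter.mp hy
      exact mem_filter.mpr ⟨hOnY y hy'.2, (mem_filter.mp hy'.1).2⟩
    have e2 : ((B.filter fun x => On x).card : ℤ) ≤ ((Y.filter fun y => ¬ ψ y = c).card : ℤ) := by exact_mod_cast hsub
    linarith
  -- assemble
  rw [← Finset.sum_filter_add_sum_filter_not Y (fun y => ψ y = c)]
  have e3 : ((A.filter fun x => On x).card : ℤ) ≤ ((B.filter fun x => On x).card : ℤ) := by exact_mod_cast hUAB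
  linarith

/-- The bound in «meeting» form: for an affine hyperplane through a point `t ∉ Y` with normal functional `ψ ≠ 0`,
`2·#{y ∈ Y : ψ y = ψ t} ≤ Σ_{y∈Y} codim_Y(y)`. -/
theorem hyperplane_mass_bound_of_notMem (Y : Finset (Fin M → ZMod 2)) (ψ : (Fin M → ZMod 2) →ₗ[ZMod 2] ZMod 2) (hψ : ψ ≠ 0)
    {t : Fin M → ZMod 2} (ht : t ∉ Y) :
    2 * ((Y.filter fun y => ψ y = ψ t).card : ℤ) ≤ ∑ y ∈ Y, (acodim M Y y : ℤ) :=
  hyperplane_mass_bound Y ψ hψ (ψ t) ⟨t, rfl, ht⟩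

end Summit.PneNP.PneNP.Theorems.ClusHyperplaneMass
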